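import Summits.HodgeConjecture.HodgeConjecture.Theorems.VHCAbelianSchemesRoadExtJumpLocusShift
import Literature.AlgebraicGeometry.HodgeTheory.HomComplexShiftedHomUnit
import HarnessLib

/-!
# Road №4 (`VHCAbelianSchemesRoad`), crux stmt-HodgeConjecture-26512 `DiagLocalOfMarkmanPinnedForall` — route «2T», step (iii), DUAL half:
# `J(E•^∨) = J(E•)⁻¹` for BOUNDED vector-bundle complexes, the displayed (β3) argument DISCHARGED

research route conditional on HC_CM; not a corollary; Q11.4-sentence-2 already refuted in dim ≥ 3.

Seat core-w5 g6 (width copy of core-D; claim-free; `--supports stmt-HodgeConjecture-26512 --as helper`; 0 new facts). Sequel to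
`VHCAbelianSchemesRoadExtJumpLocusShift.lean` §4, whose `mem_extJumpLocus_dual_iff_of_duality` composed `x ∈ J(E•^∨) ↔ x⁻¹ ∈ J(E•)` MODULO a displayed
argument `hdual` = (β3) DERIVED DUALITY for the pair `(E•, τ_x^*•E•)`. That input is now the tree theorem
`Literature.AlgebraicGeometry.HodgeTheory.HomComplex.nonempty_shiftedHom_dualComplexUnit_equiv` (`HomComplexShiftedHomUnit.lean`: for bounded complexes with
finite locally free terms, `Nonempty (Hom_D(Q F•^∨, (Q E•^∨)⟦k⟧) ≃ Hom_D(Q E•, (Q F•)⟦k⟧))`, `(–)^∨ := 𝓗om•(–, 𝒪[0])`), so for `E• ∈ [a, b]` (strictly, by instance)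
with finite locally free terms the dual half holds outright:

* `isStrictlyGE/LE_translationPullbackComplex`, `isFiniteLocallyFree_translationPullbackComplex_X` — `τ_x^*•E•` inherits the window and the
  finite-locally-free terms (`Functor.map_isZero`, `IsFiniteLocallyFree.pullback`);
* `nonempty_shiftedHom_dual_translationPullback_equiv` — the `hdual` input, for every `k`;
* **`mem_extJumpLocus_dual_iff`** — `x ∈ J(E•^∨) ↔ x⁻¹ ∈ J(E•)`; **`mem_extJumpLocus_dual_iff_of_sq_eq_one`** — at a two-torsion point `x ∈ J(E•^∨) ↔ x ∈ J(E•)`;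
* §4 (APPEND) `mem_extJumpLocus_dual_shift_iff` / `_of_sq_eq_one` — the same for print's carrier shape `𝒢•^∨⟦n⟧` (`extJumpLocus_shift` + §3).

HONEST SCOPE: `E•` must be STRICTLY bounded by instance (`[E.IsStrictlyGE a] [E.IsStrictlyLE b]`) with finite locally free terms — print's carriers are bounded
vector-bundle complexes, but a caller holding only «perfect» must first choose such a model. NOTHING here says (iii) in print's full form, (N-U♭), (N-U), the
crux, №4, HC_AV, HC_CM or HC holds; HC_CM HELD, by name only; helper lane (width toward the crux = 0).
References: [cite: Mukai1978, §3] [cite: Markman2025SecantWeil, §9.2 and §9.3 Rem. 9.3.7] [cite: Hartshorne1977, III Prop. 6.7] [cite: Weibel1994, §10.4].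
-/

noncomputable section

-- `TopCat.Presheaf`/`Scheme.Modules` are not reducible (as in Mathlib's `AlgebraicGeometry/Modules/Sheaf.lean`).
set_option backward.isDefEq.respectTransparency false

open CategoryTheory CategoryTheory.Category CategoryTheory.Limits AlgebraicGeometry

universe v u

namespace Summit.HodgeConjecture.HodgeConjecture.Ring2.SemiregularRepresentatives

set_option linter.dupNamespace false -- the cell's namespace repeats the summit name, as in every `Ring2*` file

namespace NowhereDisplaceable

open Literature.AlgebraicGeometry Literature.AlgebraicGeometry.Motives Literature.AlgebraicGeometry.Motives.AbelianVariety
open Summit.HodgeConjecture.HodgeConjecture.Ring2.SemiregularRepresentatives.MoverTrap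

/-! ## §1 `τ_x^*•E•` inherits the window and the finite-locally-free terms -/

/-- `E• ≥ a` strictly ⟹ `τ_x^*•E• ≥ a` strictly (`τ_x^*` preserves zero objects). [cite: Mukai1978, §3] -/
theorem isStrictlyGE_translationPullbackComplex (A : AbelianVariety ℂ) (x : A.Points ℂ) (E : CochainComplex A.X.left.Modules ℤ) (a : ℤ)
    [E.IsStrictlyGE a] : (translationPullbackComplex A x E).IsStrictlyGE a := by
  rw [CochainComplex.isStrictlyGE_iff]
  intro i hi
  exact Functor.map_isZero _ (E.isZero_of_isStrictlyGE a i hi)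

/-- `E• ≤ b` strictly ⟹ `τ_x^*•E• ≤ b` strictly. [cite: Mukai1978, §3] -/
theorem isStrictlyLE_translationPullbackComplex (A : AbelianVariety ℂ) (x : A.Points ℂ) (E : CochainComplex A.X.left.Modules ℤ) (b : ℤ)
    [E.IsStrictlyLE b] : (translationPullbackComplex A x E).IsStrictlyLE b := by
  rw [CochainComplex.isStrictlyLE_iff]
  intro i hi
  exact Functor.map_isZero _ (E.isZero_of_isStrictlyLE b i hi)

/-- The terms of `τ_x^*•E•` are finite locally free when those of `E•` are (`IsFiniteLocallyFree.pullback`, Stacks 01C8). [cite: StacksProject, Tag 01C8] -/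
theorem isFiniteLocallyFree_translationPullbackComplex_X (A : AbelianVariety ℂ) (x : A.Points ℂ) (E : CochainComplex A.X.left.Modules ℤ)
    (hE : ∀ i, IsFiniteLocallyFree (E.X i)) (i : ℤ) : IsFiniteLocallyFree ((translationPullbackComplex A x E).X i) :=
  (hE i).pullback (A.translation x).left

/-! ## §2 The (β3) input for the pair `(E•, τ_x^*•E•)` -/

/-- **(β3) for `(E•, τ_x^*•E•)`**: for `E• ∈ [a, b]` with finite locally free terms on a complex abelian variety, `x ∈ A(ℂ)` and `k : ℤ`,
`Nonempty (Hom_D(Q((τ_x^*•E•)^∨), Q(E•^∨)⟦k⟧) ≃ Hom_D(Q E•, Q(τ_x^*•E•)⟦k⟧))` with `E•^∨ := 𝓗om•(E•, 𝒪[0])` — the tree's derived duality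
`HomComplex.nonempty_shiftedHom_dualComplexUnit_equiv` (ROAD K: unit adjunction A twice + transpose brick B) at the windows `[a, b]`, `[a, b]`.
[cite: Hartshorne1977, III Prop. 6.7] [cite: Weibel1994, §10.4] [cite: Mukai1978, §3] -/
theorem nonempty_shiftedHom_dual_translationPullback_equiv (A : AbelianVariety ℂ) (E : CochainComplex A.X.left.Modules ℤ) (a b : ℤ)
    [E.IsStrictlyGE a] [E.IsStrictlyLE b] (hE : ∀ i, IsFiniteLocallyFree (E.X i)) (x : A.Points ℂ) (k : ℤ) :
    letI := HasDerivedCategory.standard A.X.left.Modules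
    Nonempty (ShiftedHom
        (DerivedCategory.Q.obj (HodgeTheory.homComplex A.X.left (translationPullbackComplex A x E)
          ((HomologicalComplex.single A.X.left.Modules (ComplexShape.up ℤ) 0).obj (Modules.unitModule A.X.left))))
        (DerivedCategory.Q.obj (HodgeTheory.homComplex A.X.left E
          ((HomologicalComplex.single A.X.left.Modules (ComplexShape.up ℤ) 0).obj (Modules.unitModule A.X.left)))) k ≃
      ShiftedHom (DerivedCategory.Q.obj E) (DerivedCategory.Q.obj (translationPullbackComplex A x E)) k) := by
  letI := HasDerivedCategory.standard A.X.left.Modules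
  haveI := isStrictlyGE_translationPullbackComplex A x E a
  haveI := isStrictlyLE_translationPullbackComplex A x E b
  exact HodgeTheory.HomComplex.nonempty_shiftedHom_dualComplexUnit_equiv A.X.left E (translationPullbackComplex A x E) a b a b hE
    (isFiniteLocallyFree_translationPullbackComplex_X A x E hE) k

/-! ## §3 Step (iii), dual half — unconditional for bounded vector-bundle complexes -/

/-- **`J(E•^∨) = J(E•)⁻¹`**: for a STRICTLY BOUNDED cochain complex `E• ∈ [a, b]` with finite locally free terms on a complex abelian variety and
`x ∈ A(ℂ)`, `x ∈ J(E•^∨) ↔ x⁻¹ ∈ J(E•)` (`E•^∨ := 𝓗om•(E•, 𝒪[0])`) — `mem_extJumpLocus_dual_iff_of_duality` with its displayed (β3) argument supplied by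
`nonempty_shiftedHom_dual_translationPullback_equiv`. [cite: Mukai1978, §3] [cite: Markman2025SecantWeil, §9.2 and §9.3 Rem. 9.3.7]
[cite: Hartshorne1977, III Prop. 6.7] -/
theorem mem_extJumpLocus_dual_iff (A : AbelianVariety ℂ) (E : CochainComplex A.X.left.Modules ℤ) (a b : ℤ) [E.IsStrictlyGE a] [E.IsStrictlyLE b]
    (hE : ∀ i, IsFiniteLocallyFree (E.X i)) (x : A.Points ℂ) :
    x ∈ extJumpLocus A (HodgeTheory.homComplex A.X.left E ((HomologicalComplex.single A.X.left.Modules (ComplexShape.up ℤ) 0).obj (Modules.unitModule A.X.left))) ↔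
      x⁻¹ ∈ extJumpLocus A E :=
  mem_extJumpLocus_dual_iff_of_duality A E hE x (fun k => nonempty_shiftedHom_dual_translationPullback_equiv A E a b hE x k)

/-- **At a two-torsion point `x * x = 1`: `x ∈ J(E•^∨) ↔ x ∈ J(E•)`** for `E• ∈ [a, b]` strictly with finite locally free terms — step (iii)'s dual half for
print's carrier `𝓔 = 𝒢^∨[−1]` at the points that matter (with `extJumpLocus_shift` for the shift). [cite: Mukai1978, §3] [cite: Markman2025SecantWeil, §9.3 Rem. 9.3.7] -/
theorem mem_extJumpLocus_dual_iff_of_sq_eq_one (A : AbelianVariety ℂ) (E : CochainComplex A.X.left.Modules ℤ) (a b : ℤ) [E.IsStrictlyGE a]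
    [E.IsStrictlyLE b] (hE : ∀ i, IsFiniteLocallyFree (E.X i)) {x : A.Points ℂ} (hx : x * x = 1) :
    x ∈ extJumpLocus A (HodgeTheory.homComplex A.X.left E ((HomologicalComplex.single A.X.left.Modules (ComplexShape.up ℤ) 0).obj (Modules.unitModule A.X.left))) ↔
      x ∈ extJumpLocus A E :=
  mem_extJumpLocus_dual_iff_of_duality_of_sq_eq_one A E hE hx (fun k => nonempty_shiftedHom_dual_translationPullback_equiv A E a b hE x k)

/-! ## §4 (APPEND, same seat) Print's carrier `𝓔 = 𝒢^∨⟦n⟧`: dual AND shift together -/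

/-- **`J(𝒢•^∨⟦n⟧) = J(𝒢•)⁻¹`** for `𝒢• ∈ [a, b]` strictly with finite locally free terms: `x ∈ J(𝒢•^∨⟦n⟧) ↔ x⁻¹ ∈ J(𝒢•)`
(`extJumpLocus_shift` removes the shift, `mem_extJumpLocus_dual_iff` the dual). This is the bookkeeping between the Fourier–Mukai image `𝒢` and print's
carrier `𝓔 = 𝒢^∨[−1]` (Markman §9.2). [cite: Markman2025SecantWeil, §9.2 and §9.3 Rem. 9.3.7] [cite: Mukai1978, §3] -/
theorem mem_extJumpLocus_dual_shift_iff (A : AbelianVariety ℂ) (G : CochainComplex A.X.left.Modules ℤ) (a b : ℤ) [G.IsStrictlyGE a] [G.IsStrictlyLE b]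
    (hG : ∀ i, IsFiniteLocallyFree (G.X i)) (n : ℤ) (x : A.Points ℂ) :
    x ∈ extJumpLocus A ((HodgeTheory.homComplex A.X.left G
        ((HomologicalComplex.single A.X.left.Modules (ComplexShape.up ℤ) 0).obj (Modules.unitModule A.X.left)))⟦n⟧) ↔
      x⁻¹ ∈ extJumpLocus A G := by
  rw [mem_extJumpLocus_shift_iff]
  exact mem_extJumpLocus_dual_iff A G a b hG x

/-- **At a two-torsion point, `x ∈ J(𝒢•^∨⟦n⟧) ↔ x ∈ J(𝒢•)`** (`𝒢• ∈ [a, b]` strictly, finite locally free terms, `x * x = 1`): step (iii)'s shift-and-dual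
bookkeeping for print's `𝓔 = 𝒢^∨[−1]` at the 2-torsion points, unconditionally. [cite: Markman2025SecantWeil, §9.3 Rem. 9.3.7] [cite: Mukai1978, §3] -/
theorem mem_extJumpLocus_dual_shift_iff_of_sq_eq_one (A : AbelianVariety ℂ) (G : CochainComplex A.X.left.Modules ℤ) (a b : ℤ) [G.IsStrictlyGE a]
    [G.IsStrictlyLE b] (hG : ∀ i, IsFiniteLocallyFree (G.X i)) (n : ℤ) {x : A.Points ℂ} (hx : x * x = 1) :
    x ∈ extJumpLocus A ((HodgeTheory.homComplex A.X.left G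
        ((HomologicalComplex.single A.X.left.Modules (ComplexShape.up ℤ) 0).obj (Modules.unitModule A.X.left)))⟦n⟧) ↔
      x ∈ extJumpLocus A G := by
  rw [mem_extJumpLocus_shift_iff]
  exact mem_extJumpLocus_dual_iff_of_sq_eq_one A G a b hG hx

end NowhereDisplaceable

end Summit.HodgeConjecture.HodgeConjecture.Ring2.SemiregularRepresentatives

end
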